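import Summits.RiemannHypothesis.RiemannHypothesis.Theorems.Splittings.RobinFiniteE3Combine
import HarnessLib

/-!
# Splittings — Robin finite lens, E3 (the CA Mertens certificate re-read with window hypotheses), part 3/6, §C

Cell rh-split, seat rh-split-robin-finite g7 (brief sha16 f79c5f09d8bcb036), card `run/shared/lean/pub/rh-split/cards/SPLIT-robin-finite.md` §14
(referee rh-split-ref g3 REFEREE ADDENDUM (robin, finite) §14 DELIVERABLE + REPLAY ×2 2026-08-27T05:39:31Z; lead rh-split-lead g3 RULING #24:
zero-def variant of record); cut of `HOME/rh-split-robin-finite/SketchG7-E3-zerodef.lean` (sha16 c3a3285c0daab218, 1644 l, 52 thms, ZERO defs —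
generated by the seat from SketchG7-E3.lean deb49c670b0d4cda by spelling out `ThetaWindow` / `EBoxOn` / `Eb` / `budgetPT`) into SIX files
(`RobinFiniteE3Window` §A, `…Combine` §B, `…Cells` §C, `…Large` §D, `…Error` §E, `…Main` §F; the card's five-file plan puts §A+§B in one
file, which is 428 l > the 400-line rule), filed by rh-split-typer-1 g4.  Decl blocks byte-identical to the scratch; one namespace
`…Theorems.Splittings.RobinFiniteE3` (scratch: `…Splittings.RobinFinite.E3Z`).

This part — part 3/6, §C: the cells `4¹¹ ≤ P < 4¹⁸` for any error function with the cells' box bound (`EBoxOn Ef 0.0552` spelled out), REUSING the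
landed kernel certificates `Cells.cover11RH_ok … cover17RH_ok` verbatim (`key_ineq_cellsW`).  RH-free.

E3 of the card's exchange lemma = the MECHANICAL RE-READ of the tree's CA Mertens certificate `RobinAnalyticSharp.mertens_prod_lt_RH`
with its two RH uses replaced: (θ) Schoenfeld's `|θ t − t| ≤ √t log² t/(8π)` by a WINDOW hypothesis `∀ y ∈ [599, B], |θ y − y| ≤ √y log² y/(8π)`
(spelled out), and (f) Nicolas's `−log f(P) ≤ E_RH(P)` by an ABSTRACT error value / function, so that the tree's RH-free inputs
`RobinFiniteE1c.schoenfeldThetaOn_of_buthe2016` and `RobinFiniteTail(Free).nicolasLowerBetween_PT_tailFree` plug in (in `…Main`).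
No new analytic idea: every proof is the tree's, with `hS hRH` ↦ `hW … (t ≤ B)` and `nicolasERH_mul_le` ↦ a hypothesis.
HONEST LABEL: «SPLITTING SEARCH over kernel-typed RH-EQUIVALENCES; a splitting A ∧ B ⟹ RH is CONDITIONAL bookkeeping
unless A and B are both proved; nothing here bears on the truth of RH.»  Referee labels: class (robin, finite) UNCHANGED (RELABELLING ×4,
tail-rigid); the conditional headline's modulo-list is PRINT-ONLY {Buthe2016_thm2, Buthe2018_thm2_theta, BroadbentEtAl2021_theta_rel_1e19, RH(H₀)}.
-/

set_option linter.dupNamespace false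

noncomputable section

open Real Filter Finset
open scoped Chebyshev

namespace Summit.RiemannHypothesis.RiemannHypothesis.Theorems.Splittings.RobinFiniteE3

open Literature.NumberTheory.LFunctions
open RobinAnalyticSharp

/-! ## §C · The cells `4¹¹ ≤ P < 4¹⁸` for any error function with the cells' box bound

The landed checks `Cells.cover11RH_ok … cover17RH_ok` (`decide +kernel`) certify, per cell, the inequality
`eBox 0.0552 L₁ U₁ L₂ s₁ (p16 + 0.0224) < boxes`; `Cell.soundRH` turns it into `E_RH(P) < G₂ + G₁` through
`nicolasERH_mul_le`.  Here the error is ANY function `Ef` with `Ef(P)·√P log P ≤ eBox 0.0552 … (p16 + 0.0224)` on the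
cells' parameter ranges (`EBoxOn Ef 0.0552`); the certificates are reused, not re-run. -/

/- (spelled out, was a def)  The cells' box hypothesis for an error function `Ef` at budget `b`: on every cell parameter set
(`599 ≤ P₁ ≤ P ≤ P₂`, `L₁ ≤ log P₁ ≤ U₁`, `log P₂ ≤ L₂`, `8 ≤ L₁`, `0 < s₁ ≤ √P₁`, `0 < p16`, `1 ≤ p16⁶ P₁`),
`Ef(P)·√P·log P ≤ eBox b L₁ U₁ L₂ s₁ (p16 + 0.0224)` (the shape of `nicolasERH_mul_le`). -/
/-- Sanity: `E_RH` itself satisfies the cells' box hypothesis at `b = 0.0552` (`nicolasERH_mul_le`). -/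
theorem eboxOn_nicolasERH : (∀ ⦃P P₁ P₂ L₁ U₁ L₂ s₁ p16 : ℝ⦄, 599 ≤ P₁ → P₁ ≤ P → P ≤ P₂ → L₁ ≤ Real.log P₁ → Real.log P₁ ≤ U₁ → Real.log P₂ ≤ L₂ → 8 ≤ L₁ → s₁ ≤ √P₁ → 0 < s₁ → 0 < p16 → 1 ≤ p16 ^ 6 * P₁ → nicolasERH P * (√P * Real.log P) ≤ eBox ((Cells.bU : ℚ) : ℝ) L₁ U₁ L₂ s₁ (p16 + 0.0224)) := by
  intro P P₁ P₂ L₁ U₁ L₂ s₁ p16 hP₁ hPl hPu hL₁ hU₁ hL₂ hL₁8 hs₁ hs₁0 hp16 hp16'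
  have hb : nicolasBeta ≤ ((Cells.bU : ℚ) : ℝ) := by
    have := nicolasBeta_lt; simp only [Cells.bU]; push_cast; linarith
  have hb2 : ((Cells.bU : ℚ) : ℝ) ≤ 2 := by simp only [Cells.bU]; push_cast; norm_num
  exact nicolasERH_mul_le hb hb2 hP₁ hPl hPu hL₁ hU₁ hL₂ hL₁8 hs₁ hs₁0 hp16 hp16'

section CellsW
open RobinAnalyticSharp.Cells

/-- `Cell.soundRH` for an abstract error function (proof verbatim; ends in `cell_keyW`). -/
theorem cell_soundW {B : ℝ} (hW : (∀ y : ℝ, 599 ≤ y → y ≤ B → |θ y - y| ≤ √y * Real.log y ^ 2 / (8 * π))) {Ef : ℝ → ℝ} (hEf : (∀ ⦃P P₁ P₂ L₁ U₁ L₂ s₁ p16 : ℝ⦄, 599 ≤ P₁ → P₁ ≤ P → P ≤ P₂ → L₁ ≤ Real.log P₁ → Real.log P₁ ≤ U₁ → Real.log P₂ ≤ L₂ → 8 ≤ L₁ → s₁ ≤ √P₁ → 0 < s₁ → 0 < p16 → 1 ≤ p16 ^ 6 * P₁ → Ef P * (√P * Real.log P) ≤ eBox ((bU : ℚ) : ℝ)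 L₁ U₁ L₂ s₁ (p16 + 0.0224)))
    (c : Cell) (hc : c.checkRH = true) {P Q : ℕ} (hPl : 4 ^ c.k ≤ P) (hPu : P ≤ 4 ^ (c.k + 1))
    (hPB : (P : ℝ) ≤ B) (hQ : 599 ≤ Q) (hQP : Q ≤ P)
    (hQ₁ : (c.A₁.n : ℝ) * √(P : ℝ) ≤ (Q : ℝ) * 2 ^ c.k)
    (hQ₂ : (Q : ℝ) * 2 ^ c.k ≤ (c.A₂.n : ℝ) * √(P : ℝ)) :
    Ef P <
      ∑ p ∈ (Nat.primesLE P).filter (fun p => Q < p), ((p : ℝ) ^ 2)⁻¹ +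
        θ Q / ((θ P + θ Q) * Real.log (θ P + θ Q)) := by
  simp only [Cell.checkRH, Bool.and_eq_true, decide_eq_true_eq] at hc
  obtain ⟨hc, hcellRH⟩ := hc
  simp only [Cell.check, Bool.and_eq_true, Bool.or_eq_true, decide_eq_true_eq] at hc
  obtain ⟨⟨⟨⟨⟨⟨⟨⟨⟨⟨hA₁, hA₂⟩, hn⟩, hk⟩, hp0⟩, hp6⟩, hd1⟩, hell0⟩, hκ⟩, hla⟩, -⟩ := hc
  obtain ⟨hP₁599, hL₁, hU₁, hL₂, hL₁8, hs₁, hs₁0⟩ := range_facts hk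
  have hPl' : (4 : ℝ) ^ c.k ≤ P := by exact_mod_cast hPl
  have hPu' : (P : ℝ) ≤ (4 : ℝ) ^ (c.k + 1) := by exact_mod_cast hPu
  have h2k : (0 : ℝ) < 2 ^ c.k := by positivity
  have hP0 : (0 : ℝ) < P := lt_of_lt_of_le (by positivity) hPl'
  -- `a₁`, `a₂`
  have ha₁ : ((c.a1 : ℚ) : ℝ) * √(P : ℝ) ≤ Q := by
    simp only [Cell.a1]; push_cast
    rw [div_mul_eq_mul_div, div_le_iff₀ h2k]; exact hQ₁
  have ha₂ : (Q : ℝ) ≤ ((c.a2 : ℚ) : ℝ) * √(P : ℝ) := by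
    simp only [Cell.a2]; push_cast
    rw [div_mul_eq_mul_div, le_div_iff₀ h2k]; exact hQ₂
  have ha₁0 : (0 : ℝ) ≤ ((c.a1 : ℚ) : ℝ) := by simp only [Cell.a1]; push_cast; positivity
  have hn₂ : (1 : ℝ) ≤ c.A₂.n := by exact_mod_cast (Nat.succ_le_of_lt (lt_of_le_of_lt (Nat.zero_le _) hn))
  have ha₂0 : (0 : ℝ) < ((c.a2 : ℚ) : ℝ) := by simp only [Cell.a2]; push_cast; positivity
  -- the anchor `a₁ √P₁ = n₁`
  have e₁ : ((c.a1 : ℚ) : ℝ) * √((4 : ℝ) ^ c.k) = c.A₁.n := by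
    rw [sqrt_four_pow]; simp only [Cell.a1]; push_cast; field_simp
  have hd₁ : schoenfeldDelta (max 599 (((c.a1 : ℚ) : ℝ) * √((4 : ℝ) ^ c.k))) ≤ ((c.d1 : ℚ) : ℝ) := by
    rw [e₁]
    by_cases h : 599 ≤ c.A₁.n
    · have hv : c.A₁.valid = true := hA₁.resolve_left (not_lt.2 h)
      rw [max_eq_right (by exact_mod_cast h)]
      simp only [Cell.d1, if_pos h]
      exact c.A₁.delta_le hv
    · push Not at h
      rw [max_eq_left (by exact_mod_cast h.le)]
      simp only [Cell.d1, if_neg (not_le.2 h), d599]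
      have := schoenfeldDelta_599_le
      push_cast; linarith
  have hd₁1 : ((c.d1 : ℚ) : ℝ) ≤ 1 / 2 := by
    have h := (Rat.cast_le (K := ℝ)).2 hd1; push_cast at h; exact h
  have hdP : schoenfeldDelta ((4 : ℝ) ^ c.k) ≤ ((dP c.k : ℚ) : ℝ) := dP_sound c.k
  have hℓ₁ : ((c.ell1 : ℚ) : ℝ) ≤ Real.log (max 599 (((c.a1 : ℚ) : ℝ) * √((4 : ℝ) ^ c.k))) := by
    rw [e₁]
    by_cases h : 599 ≤ c.A₁.n
    · have hv : c.A₁.valid = true := hA₁.resolve_left (not_lt.2 h)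
      rw [max_eq_right (by exact_mod_cast h)]
      simp only [Cell.ell1, if_pos h]
      exact (c.A₁.log_bounds hv).1
    · push Not at h
      rw [max_eq_left (by exact_mod_cast h.le)]
      simp only [Cell.ell1, if_neg (not_le.2 h)]
      exact ell599_le
  have hℓ₁0 : (0 : ℝ) < ((c.ell1 : ℚ) : ℝ) := by exact_mod_cast hell0
  have hp16 : (0 : ℝ) < ((c.p16 : ℚ) : ℝ) := by exact_mod_cast hp0
  have hp16' : (1 : ℝ) ≤ ((c.p16 : ℚ) : ℝ) ^ 6 * (4 : ℝ) ^ c.k := by exact_mod_cast hp6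
  have hL₁0 : (0 : ℝ) < ((L1 c.k : ℚ) : ℝ) := by linarith
  -- `mlow`
  obtain ⟨hm0, hm⟩ := c.mlow_facts hA₂ hla hL₁0 ha₂0
  have hcR : (1 + ((dP c.k : ℚ) : ℝ)) + (1 + ((c.d1 : ℚ) : ℝ)) * ((c.a2 : ℚ) : ℝ) / ((s1 c.k : ℚ) : ℝ) ≤
      ((c.cR : ℚ) : ℝ) := by
    simp only [Cell.cR]; push_cast; exact le_rfl
  have hκ' : (0 : ℝ) ≤ (1 - ((c.d1 : ℚ) : ℝ)) * (((c.ell1 : ℚ) : ℝ) / (((c.ell1 : ℚ) : ℝ) + 1)) -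
      2 * ((c.d1 : ℚ) : ℝ) := by
    have : (0 : ℝ) ≤ ((c.kappa : ℚ) : ℝ) := by exact_mod_cast hκ
    simp only [Cell.kappa] at this; push_cast at this; exact this
  have ebump : (((c.p16 + bump : ℚ)) : ℝ) = ((c.p16 : ℚ) : ℝ) + 0.0224 := by
    push_cast [bump]; norm_num
  have hcell' : eBox ((bU : ℚ) : ℝ) (L1 c.k : ℝ) (U1 c.k : ℝ) (L2 c.k : ℝ) (s1 c.k : ℝ) ((c.p16 : ℝ) + 0.0224) <
      g1Box (c.d1 : ℝ) (c.a1 : ℝ) (c.cR : ℝ) (L1 c.k : ℝ) + g2Box (c.d1 : ℝ) (c.ell1 : ℝ) (c.mlow : ℝ) (s1 c.k : ℝ) := by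
    rw [← ebump, ← eBoxQ_cast, ← g1BoxQ_cast, ← g2BoxQ_cast]; exact_mod_cast hcellRH
  have hE := hEf hP₁599 hPl' hPu' hL₁ hU₁ hL₂ hL₁8 hs₁ hs₁0 hp16 hp16'
  exact cell_keyW hW hQ hQP hPB hP₁599 hPl' ha₁ ha₂ ha₁0 ha₂0 hd₁ hd₁1 hdP hℓ₁ hℓ₁0 hL₁ hL₁0 hs₁ hs₁0
    hm0 hm hcR hκ' (hE.trans_lt hcell')

/-- `Cell.soundFirstRH` for an abstract error function (ends in `small_Q_keyW`). -/
theorem cell_soundFirstW {B : ℝ} (hW : (∀ y : ℝ, 599 ≤ y → y ≤ B → |θ y - y| ≤ √y * Real.log y ^ 2 / (8 * π))) {Ef : ℝ → ℝ} (hEf : (∀ ⦃P P₁ P₂ L₁ U₁ L₂ s₁ p16 : ℝ⦄, 599 ≤ P₁ → P₁ ≤ P → P ≤ P₂ → L₁ ≤ Real.log P₁ → Real.log P₁ ≤ U₁ → Real.log P₂ ≤ L₂ → 8 ≤ L₁ → s₁ ≤ √P₁ → 0 < s₁ → 0 < p16 → 1 ≤ p16 ^ 6 * P₁ → Ef P *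 (√P * Real.log P) ≤ eBox ((bU : ℚ) : ℝ) L₁ U₁ L₂ s₁ (p16 + 0.0224)))
    (c : Cell) (hc : c.checkFirstRH = true) (hn₂ : 599 ≤ c.A₂.n) {P Q : ℕ} (hPl : 4 ^ c.k ≤ P)
    (hPu : P ≤ 4 ^ (c.k + 1)) (hPB : (P : ℝ) ≤ B) (hQ : Q ≤ 599) :
    Ef P <
      ∑ p ∈ (Nat.primesLE P).filter (fun p => Q < p), ((p : ℝ) ^ 2)⁻¹ +
        θ Q / ((θ P + θ Q) * Real.log (θ P + θ Q)) := by
  simp only [Cell.checkFirstRH, Bool.and_eq_true, decide_eq_true_eq] at hc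
  obtain ⟨hc, hcellRH⟩ := hc
  simp only [Cell.checkFirst, Cell.check, Bool.and_eq_true, Bool.or_eq_true, decide_eq_true_eq,
    beq_iff_eq] at hc
  obtain ⟨⟨⟨⟨⟨⟨⟨⟨⟨⟨⟨⟨hA₁, hA₂⟩, hn⟩, hk⟩, hp0⟩, hp6⟩, hd1⟩, hell0⟩, hκ⟩, hla⟩, -⟩, hzero⟩, -⟩ := hc
  obtain ⟨hP₁599, hL₁, hU₁, hL₂, hL₁8, hs₁, hs₁0⟩ := range_facts hk
  have hPl' : (4 : ℝ) ^ c.k ≤ P := by exact_mod_cast hPl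
  have hPu' : (P : ℝ) ≤ (4 : ℝ) ^ (c.k + 1) := by exact_mod_cast hPu
  have h2k : (0 : ℝ) < 2 ^ c.k := by positivity
  have h599P : 599 ≤ P := by
    have : (599 : ℝ) ≤ P := hP₁599.trans hPl'
    exact_mod_cast this
  have hn₂r : (599 : ℝ) ≤ c.A₂.n := by exact_mod_cast hn₂
  have ha₂0 : (0 : ℝ) < ((c.a2 : ℚ) : ℝ) := by simp only [Cell.a2]; push_cast; positivity
  have ha₂ : (599 : ℝ) ≤ ((c.a2 : ℚ) : ℝ) * √(P : ℝ) := by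
    simp only [Cell.a2]; push_cast
    have hsP : (2 : ℝ) ^ c.k ≤ √(P : ℝ) := by rw [← sqrt_four_pow]; exact Real.sqrt_le_sqrt hPl'
    rw [div_mul_eq_mul_div, le_div_iff₀ h2k]
    calc (599 : ℝ) * 2 ^ c.k ≤ c.A₂.n * 2 ^ c.k := by gcongr
      _ ≤ c.A₂.n * √(P : ℝ) := by gcongr
  have hlt : c.A₁.n < 599 := by rw [hzero]; norm_num
  have hd₁ : schoenfeldDelta 599 ≤ ((c.d1 : ℚ) : ℝ) := by
    simp only [Cell.d1, if_neg (not_le.2 hlt), d599]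
    have := schoenfeldDelta_599_le; push_cast; linarith
  have hd₁1 : ((c.d1 : ℚ) : ℝ) ≤ 1 / 2 := by
    have h := (Rat.cast_le (K := ℝ)).2 hd1; push_cast at h; exact h
  have hℓ₁ : ((c.ell1 : ℚ) : ℝ) ≤ Real.log 599 := by
    simp only [Cell.ell1, if_neg (not_le.2 hlt)]; exact ell599_le
  have hℓ₁0 : (0 : ℝ) < ((c.ell1 : ℚ) : ℝ) := by exact_mod_cast hell0
  have hp16 : (0 : ℝ) < ((c.p16 : ℚ) : ℝ) := by exact_mod_cast hp0
  have hp16' : (1 : ℝ) ≤ ((c.p16 : ℚ) : ℝ) ^ 6 * (4 : ℝ) ^ c.k := by exact_mod_cast hp6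
  have hL₁0 : (0 : ℝ) < ((L1 c.k : ℚ) : ℝ) := by linarith
  obtain ⟨hm0, hm⟩ := c.mlow_facts hA₂ hla hL₁0 ha₂0
  have hκ' : (0 : ℝ) ≤ (1 - ((c.d1 : ℚ) : ℝ)) * (((c.ell1 : ℚ) : ℝ) / (((c.ell1 : ℚ) : ℝ) + 1)) -
      2 * ((c.d1 : ℚ) : ℝ) := by
    have : (0 : ℝ) ≤ ((c.kappa : ℚ) : ℝ) := by exact_mod_cast hκ
    simp only [Cell.kappa] at this; push_cast at this; exact this
  have ebump : (((c.p16 + bump : ℚ)) : ℝ) = ((c.p16 : ℚ) : ℝ) + 0.0224 := by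
    push_cast [bump]; norm_num
  have hcell' : eBox ((bU : ℚ) : ℝ) (L1 c.k : ℝ) (U1 c.k : ℝ) (L2 c.k : ℝ) (s1 c.k : ℝ) ((c.p16 : ℝ) + 0.0224) <
      g2Box (c.d1 : ℝ) (c.ell1 : ℝ) (c.mlow : ℝ) (s1 c.k : ℝ) := by
    rw [← ebump, ← eBoxQ_cast, ← g2BoxQ_cast]; exact_mod_cast hcellRH
  have hE := hEf hP₁599 hPl' hPu' hL₁ hU₁ hL₂ hL₁8 hs₁ hs₁0 hp16 hp16'
  exact small_Q_keyW hW hQ h599P hPB hP₁599 hPl' ha₂ ha₂0 hd₁ hd₁1 hℓ₁ hℓ₁0 hL₁ hs₁ hs₁0 hm0 hm hκ'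
    (hE.trans_lt hcell')

/-- `tail_soundRH` for an abstract error function (ends in `large_Q_keyW`). -/
theorem tail_soundW {B : ℝ} (hW : (∀ y : ℝ, 599 ≤ y → y ≤ B → |θ y - y| ≤ √y * Real.log y ^ 2 / (8 * π))) {Ef : ℝ → ℝ} (hEf : (∀ ⦃P P₁ P₂ L₁ U₁ L₂ s₁ p16 : ℝ⦄, 599 ≤ P₁ → P₁ ≤ P → P ≤ P₂ → L₁ ≤ Real.log P₁ → Real.log P₁ ≤ U₁ → Real.log P₂ ≤ L₂ → 8 ≤ L₁ → s₁ ≤ √P₁ → 0 < s₁ → 0 < p16 → 1 ≤ p16 ^ 6 * P₁ → Ef P * (√P * Real.log P) ≤ eBox ((bU : ℚ) : ℝ) L₁ U₁ L₂ s₁ (p16 + 0.0224)))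
    (k : ℕ) (A : Anchor)
    (p16 : ℚ) (h : checkTailRH k A p16 = true) (hn : 599 ≤ A.n) {P Q : ℕ} (hPl : 4 ^ k ≤ P)
    (hPu : P ≤ 4 ^ (k + 1)) (hPB : (P : ℝ) ≤ B) (hQ : 599 ≤ Q) (hQP : Q ≤ P)
    (hQ₁ : (A.n : ℝ) * √(P : ℝ) ≤ (Q : ℝ) * 2 ^ k) :
    Ef P <
      ∑ p ∈ (Nat.primesLE P).filter (fun p => Q < p), ((p : ℝ) ^ 2)⁻¹ +
        θ Q / ((θ P + θ Q) * Real.log (θ P + θ Q)) := by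
  simp only [checkTailRH, Bool.and_eq_true, decide_eq_true_eq] at h
  obtain ⟨h, hcellRH⟩ := h
  simp only [checkTail, Bool.and_eq_true, decide_eq_true_eq] at h
  obtain ⟨⟨⟨⟨⟨hA, hk⟩, hp0⟩, hp6⟩, hd1⟩, -⟩ := h
  obtain ⟨hP₁599, hL₁, hU₁, hL₂, hL₁8, hs₁, hs₁0⟩ := range_facts hk
  have hPl' : (4 : ℝ) ^ k ≤ P := by exact_mod_cast hPl
  have hPu' : (P : ℝ) ≤ (4 : ℝ) ^ (k + 1) := by exact_mod_cast hPu
  have h2k : (0 : ℝ) < 2 ^ k := by positivity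
  set a : ℝ := (A.n : ℝ) / 2 ^ k with ha_def
  have ha : a * √(P : ℝ) ≤ Q := by
    rw [ha_def, div_mul_eq_mul_div, div_le_iff₀ h2k]; exact hQ₁
  have ha0 : 0 ≤ a := by rw [ha_def]; positivity
  have e₁ : a * √((4 : ℝ) ^ k) = A.n := by rw [sqrt_four_pow, ha_def]; field_simp
  have hnr : (599 : ℝ) ≤ A.n := by exact_mod_cast hn
  have hd₁ : schoenfeldDelta (max 599 (a * √((4 : ℝ) ^ k))) ≤ ((A.deltaU : ℚ) : ℝ) := by
    rw [e₁, max_eq_right hnr]; exact A.delta_le hA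
  have hd₁1 : ((A.deltaU : ℚ) : ℝ) ≤ 1 / 2 := by
    have h := (Rat.cast_le (K := ℝ)).2 hd1; push_cast at h; exact h
  have hdP : schoenfeldDelta ((4 : ℝ) ^ k) ≤ ((dP k : ℚ) : ℝ) := dP_sound k
  have hp16 : (0 : ℝ) < ((p16 : ℚ) : ℝ) := by exact_mod_cast hp0
  have hp16' : (1 : ℝ) ≤ ((p16 : ℚ) : ℝ) ^ 6 * (4 : ℝ) ^ k := by exact_mod_cast hp6
  have hc : 2 + ((dP k : ℚ) : ℝ) + ((A.deltaU : ℚ) : ℝ) ≤ 2 + ((dP k : ℚ) : ℝ) + ((A.deltaU : ℚ) : ℝ) :=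
    le_rfl
  have ebump : (((p16 + bump : ℚ)) : ℝ) = ((p16 : ℚ) : ℝ) + 0.0224 := by
    push_cast [bump]; norm_num
  have hcell' : eBox ((bU : ℚ) : ℝ) (L1 k : ℝ) (U1 k : ℝ) (L2 k : ℝ) (s1 k : ℝ) ((p16 : ℝ) + 0.0224) <
      (1 - ((A.deltaU : ℚ) : ℝ)) * a / ((2 + ((dP k : ℚ) : ℝ) + ((A.deltaU : ℚ) : ℝ)) *
        (1 + ((2 + ((dP k : ℚ) : ℝ) + ((A.deltaU : ℚ) : ℝ)) - 1) / ((L1 k : ℚ) : ℝ))) := by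
    rw [← ebump, ← eBoxQ_cast, ha_def]
    have h := (Rat.cast_lt (K := ℝ)).2 hcellRH
    push_cast at h
    exact h
  have hE := hEf hP₁599 hPl' hPu' hL₁ hU₁ hL₂ hL₁8 hs₁ hs₁0 hp16 hp16'
  have hL₁0 : (0 : ℝ) < ((L1 k : ℚ) : ℝ) := by linarith
  exact large_Q_keyW hW hQ hQP hPB hP₁599 hPl' ha ha0 hd₁ hd₁1 hdP hL₁ hL₁0 hc (hE.trans_lt hcell')

/-- `cover_keyRH` for an abstract error function. -/
theorem cover_keyW {B : ℝ} (hW : (∀ y : ℝ, 599 ≤ y → y ≤ B → |θ y - y| ≤ √y * Real.log y ^ 2 / (8 * π))) {Ef : ℝ → ℝ} (hEf : (∀ ⦃P P₁ P₂ L₁ U₁ L₂ s₁ p16 : ℝ⦄, 599 ≤ P₁ → P₁ ≤ P → P ≤ P₂ → L₁ ≤ Real.log P₁ → Real.log P₁ ≤ U₁ → Real.log P₂ ≤ L₂ → 8 ≤ L₁ → s₁ ≤ √P₁ → 0 < s₁ → 0 < p16 → 1 ≤ p16 ^ 6 * P₁ → Ef P * (√P * Real.log P) ≤ eBox ((bU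 : ℚ) : ℝ) L₁ U₁ L₂ s₁ (p16 + 0.0224)))
    {k : ℕ} {l : List Cell}
    {T : Anchor} {p16 : ℚ} (h : coverOKRH k l T p16 = true) {P Q : ℕ} (hPl : 4 ^ k ≤ P)
    (hPu : P ≤ 4 ^ (k + 1)) (hPB : (P : ℝ) ≤ B) (hQP : Q ≤ P) :
    Ef P <
      ∑ p ∈ (Nat.primesLE P).filter (fun p => Q < p), ((p : ℝ) ^ 2)⁻¹ +
        θ Q / ((θ P + θ Q) * Real.log (θ P + θ Q)) := by
  match l, h with
  | c₀ :: t, h =>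
    simp only [coverOKRH, Bool.and_eq_true, decide_eq_true_eq, beq_iff_eq, List.all_eq_true] at h
    obtain ⟨⟨⟨⟨⟨⟨hfirst, h599⟩, hT599⟩, hall⟩, hchain⟩, hlast⟩, htail⟩ := h
    have hk0 : c₀.k = k := (hall c₀ (by simp)).2
    have hPl' : (4 : ℝ) ^ k ≤ P := by exact_mod_cast hPl
    have hP0 : (0 : ℝ) < P := lt_of_lt_of_le (by positivity) hPl'
    have hsP : 0 < √(P : ℝ) := Real.sqrt_pos.2 hP0
    have h2k : (0 : ℝ) < 2 ^ k := by positivity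
    rcases le_or_gt Q 599 with hQ | hQ
    · -- small `Q`
      exact cell_soundFirstW hW hEf c₀ hfirst h599 (hk0 ▸ hPl) (hk0 ▸ hPu) hPB hQ
    · have hQ' : 599 ≤ Q := hQ.le
      set x : ℝ := (Q : ℝ) * 2 ^ k / √(P : ℝ) with hx
      rcases le_or_gt (T.n : ℝ) x with hT | hT
      · -- the tail
        refine tail_soundW hW hEf k T p16 htail hT599 hPl hPu hPB hQ' hQP ?_
        rwa [hx, le_div_iff₀ hsP] at hT
      · -- a cell
        have hzero : c₀.A₁.n = 0 := by
          simp only [Cell.checkFirstRH, Cell.checkFirst, Bool.and_eq_true, beq_iff_eq,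
            decide_eq_true_eq] at hfirst
          exact hfirst.1.1.2
        have hx0 : (c₀.A₁.n : ℝ) ≤ x := by rw [hzero, Nat.cast_zero]; positivity
        have hxl : x ≤ lastN (c₀ :: t) := by rw [hlast]; exact hT.le
        obtain ⟨c, hc, hc1, hc2⟩ := exists_bracket t c₀ hchain x hx0 hxl
        obtain ⟨hcc, hck⟩ := hall c hc
        refine cell_soundW hW hEf c hcc (hck ▸ hPl) (hck ▸ hPu) hPB hQ' hQP ?_ ?_
        · rw [hck]; rwa [hx, le_div_iff₀ hsP] at hc1
        · rw [hck]; rwa [hx, div_le_iff₀ hsP] at hc2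

/-- **Key inequality on the cells `4¹¹ ≤ P < 4¹⁸`** for any `Ef` with `EBoxOn Ef 0.0552`, from the window
`θ`-bound up to `B ≥ P` — the landed certificates `cover11RH_ok … cover17RH_ok` reused verbatim. -/
theorem key_ineq_cellsW {B : ℝ} (hW : (∀ y : ℝ, 599 ≤ y → y ≤ B → |θ y - y| ≤ √y * Real.log y ^ 2 / (8 * π))) {Ef : ℝ → ℝ} (hEf : (∀ ⦃P P₁ P₂ L₁ U₁ L₂ s₁ p16 : ℝ⦄, 599 ≤ P₁ → P₁ ≤ P → P ≤ P₂ → L₁ ≤ Real.log P₁ → Real.log P₁ ≤ U₁ → Real.log P₂ ≤ L₂ → 8 ≤ L₁ → s₁ ≤ √P₁ → 0 < s₁ → 0 < p16 → 1 ≤ p16 ^ 6 * P₁ → Ef P * (√P * Real.log P) ≤ eBox ((bU : ℚ) : ℝ) L₁ U₁ L₂ s₁ (p16 + 0.0224)))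
    {P Q : ℕ} (hP : 4 ^ 11 ≤ P) (hP' : P < 4 ^ 18) (hPB : (P : ℝ) ≤ B) (hQP : Q ≤ P) :
    Ef P <
      ∑ p ∈ (Nat.primesLE P).filter (fun p => Q < p), ((p : ℝ) ^ 2)⁻¹ +
        θ Q / ((θ P + θ Q) * Real.log (θ P + θ Q)) := by
  have hP0 : P ≠ 0 := by intro h; rw [h] at hP; norm_num at hP
  have hk1 : 4 ^ Nat.log 4 P ≤ P := Nat.pow_log_le_self 4 hP0
  have hk2 : P < 4 ^ (Nat.log 4 P + 1) := Nat.lt_pow_succ_log_self (by norm_num) P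
  have hk11 : 11 ≤ Nat.log 4 P := Nat.le_log_of_pow_le (by norm_num) hP
  have hk17 : Nat.log 4 P < 18 := Nat.log_lt_of_lt_pow hP0 hP'
  set k := Nat.log 4 P with hk
  interval_cases k
  · exact cover_keyW hW hEf cover11RH_ok hk1 hk2.le hPB hQP
  · exact cover_keyW hW hEf cover12RH_ok hk1 hk2.le hPB hQP
  · exact cover_keyW hW hEf cover13RH_ok hk1 hk2.le hPB hQP
  · exact cover_keyW hW hEf cover14RH_ok hk1 hk2.le hPB hQP
  · exact cover_keyW hW hEf cover15RH_ok hk1 hk2.le hPB hQP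
  · exact cover_keyW hW hEf cover16RH_ok hk1 hk2.le hPB hQP
  · exact cover_keyW hW hEf cover17RH_ok hk1 hk2.le hPB hQP

end CellsW

end Summit.RiemannHypothesis.RiemannHypothesis.Theorems.Splittings.RobinFiniteE3

end
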